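import Summits.AnomalousDissipation.AnomalousDissipation.Theorems.SolenoidalFractalHomogenisationLagrangianStepVmodFrameAssemblyJ
import Summits.AnomalousDissipation.AnomalousDissipation.Theorems.SolenoidalFractalHomogenisationLagrangianStepVmodFrameDefsJA
import HarnessLib

/-!
# K1L_D (stmt-AnomalousDissipation-27980), (ℓ3-A) road A: the TWISTED ASSEMBLY over the v3A texts (amendment 2, `…VmodFrameDefsJA`)
(helper; `--supports 27980 --as helper`; prover ad-k1loc-p3 g11; RULING D28-22 (2) «threaded … assembly port».)

`modECW0FJA_of_blockBoundsGJA_at`: four `BlockBoundGJA` + `NearMultGJA κ` (`κ < 1`) ⇒ `SlowVectorClauseModECW0FJA … ((C₁+C₂+C₃+C₄)/(1−κ))` —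
the p728018 proof byte-for-byte with the binders `nC ≤ ϱ₁ * (ν / K) ^ (4/3 : ℝ) * n` and `IsFrameRegular6 θ Tw nC G J` passed through
(the assembly does not use them).  Consumed by lead g7's head `vmod_EXK_of_VRH0FJA`.
`sorry`-free; NOT a proof of any block, of K1L_D or of AD; rung F-D1.A0.
-/

set_option linter.dupNamespace false

noncomputable section

namespace Summit.AnomalousDissipation.AnomalousDissipation.Theorems.SolenoidalFractalHomogenisation.LagrangianStep.VmodDist

open Literature.Analysis Literature.Analysis.FluidPDE Literature.Analysis.FunctionSpaces
open MeasureTheory Set UnitAddTorus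
open scoped InnerProductSpace
open Summit.AnomalousDissipation.AnomalousDissipation.Theorems.SolenoidalFractalHomogenisation.LagrangianStep.CellClauseMod
open Summit.AnomalousDissipation.AnomalousDissipation.Theorems.SolenoidalFractalHomogenisation.LagrangianStep.LossCurrency
open Summit.AnomalousDissipation.AnomalousDissipation.Theorems.SolenoidalFractalHomogenisation.LagrangianStep.VmodFlat
  (IsSlow IsFast fc fc_sub inner_eq_zero_of_fc_disjoint eta_sum_le)

/-! ## The twisted assembly, v3A -/

set_option maxHeartbeats 1600000 in
/-- **(ℓ3-A) TWISTED ASSEMBLY v3A, pointwise**: `NearMultGJA … κ` (`0 ≤ κ < 1`) and the four `BlockBoundGJA` blocks give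
`SlowVectorClauseModECW0FJA … ((C₁+C₂+C₃+C₄)/(1−κ)) …` — `modECW0FJ_of_blockBoundsGJ_at` (p728018) VERBATIM with the two v3A binders
(cascade token `hnCK`, (F6) token `hR6`) threaded to the blocks and to `NearMultGJA`. -/
theorem modECW0FJA_of_blockBoundsGJA_at {k : ℕ} (W : LatticeShear.LatticeWord k) (M : ℝ) (hM : 0 < M) {c : ℝ}
    (Φ : ℝ → Torus.Visc4 (Fin 3) → Torus.Visc4 (Fin 3)) {lo hi Λ β σ' C₁ C₂ C₃ C₄ ν₀ K θ₁ ϱ₁ κ : ℝ}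
    (hκ0 : 0 ≤ κ) (hκ : κ < 1) (hC₁ : 0 ≤ C₁) (hC₂ : 0 ≤ C₂) (hC₃ : 0 ≤ C₃) (hC₄ : 0 ≤ C₄)
    (hNM : NearMultGJA c Φ lo hi Λ β ν₀ K θ₁ ϱ₁ κ)
    (B₁ : BlockBoundGJA W M hM c Φ lo hi Λ β σ' C₁ ν₀ K θ₁ ϱ₁ IsSlow IsSlow) (B₂ : BlockBoundGJA W M hM c Φ lo hi Λ β σ' C₂ ν₀ K θ₁ ϱ₁ IsSlow IsFast)
    (B₃ : BlockBoundGJA W M hM c Φ lo hi Λ β σ' C₃ ν₀ K θ₁ ϱ₁ IsFast IsSlow) (B₄ : BlockBoundGJA W M hM c Φ lo hi Λ β σ' C₄ ν₀ K θ₁ ϱ₁ IsFast IsFast) :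
    SlowVectorClauseModECW0FJA W M hM c Φ lo hi Λ β σ' ((C₁ + C₂ + C₃ + C₄) / (1 - κ)) ν₀ K θ₁ ϱ₁ := by
  intro ν hν n hn 𝔸 hodd hwin hΦo hΦw θ hθ nC hnC0 hnC hnCK Tw hTw G hG J hR hR6 U T hU hT t ht0 htT x ζ
  have hGt : ∀ a c', Continuous fun y => G t y a c' := fun a c' => continuous_entry_of_jointCont hR.jointContG t a c'
  -- the DATUM split at the frequency ball `freqBall (n/4)` (flat classes at the reset; verbatim)
  set A : Set (Fin 3 → ℤ) := ↑(Torus.freqBall (d := Fin 3) (n / 4)) with hA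
  have hAsym : ∀ k', k' ∈ A ↔ -k' ∈ A := fun k' => by
    rw [hA, Finset.mem_coe, Finset.mem_coe, Torus.neg_mem_freqBall]
  obtain ⟨P, hP⟩ := exists_labelProj A hAsym
  have hPoff : ∀ (y : V2) (k' : Fin 3 → ℤ), k' ∉ Torus.freqBall (d := Fin 3) (n / 4) → fc (P y) k' = 0 := by
    intro y k' hk'
    have h := hP y k'
    rw [if_neg (by rwa [hA, Finset.mem_coe] : k' ∉ A)] at h
    exact h
  have hPon : ∀ (y : V2) (k' : Fin 3 → ℤ), k' ∈ Torus.freqBall (d := Fin 3) (n / 4) → fc (P y) k' = fc y k' := by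
    intro y k' hk'
    have h := hP y k'
    rw [if_pos (by rwa [hA, Finset.mem_coe] : k' ∈ A)] at h
    exact h
  set xs : V2 := P x with hxs
  set xf : V2 := x - P x with hxf
  have hx : x = xs + xf := by rw [hxs, hxf]; abel
  have hxs_s : IsSlow n xs := fun k' hk' => hPoff x k' hk'
  have hxf_f : IsFast n xf := fun k' hk' => by rw [hxf, fc_sub, hPon x k' hk', sub_self]
  have disj : ∀ {y y' : V2}, IsSlow n y → IsFast n y' → ∀ k', fc y k' = 0 ∨ fc y' k' = 0 := by
    intro y y' hy hy' k'
    by_cases hk' : k' ∈ Torus.freqBall (d := Fin 3) (n / 4)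
    · exact Or.inr (hy' k' hk')
    · exact Or.inl (hy k' hk')
  have hox : ⟪xs, xf⟫_ℝ = 0 := inner_eq_zero_of_fc_disjoint (disj hxs_s hxf_f)
  -- the TEST: projection onto the `G(t)`-solenoidal class, then the twisted split
  set Kt : Submodule ℝ V2 := solClass (G t) with hKt
  haveI : Kt.HasOrthogonalProjection := hasOrthogonalProjection_solClass (G t)
  have hrangeT : ∀ y : V2, T 0 t y ∈ Kt := fun y => hT.toIsDistortedPropagator.apply_mem_solClass hGt 0 y
  have hrangeU : ∀ y : V2, U 0 t y ∈ Kt := fun y => hU.toIsDistortedPropagator.apply_mem_solClass hGt 0 y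
  set ζ' : V2 := Kt.starProjection ζ with hζ'
  have hζ'K : ζ' ∈ Kt := Kt.starProjection_apply_mem ζ
  obtain ⟨φs, φf, hsplitζ, hφs_s, hφf_f, hφs_div, hφf_div⟩ := exists_twistedSplit hR n t hζ'K
  set ψs : V2 := corrTest (J t) φs with hψs
  set ψf : V2 := corrTest (J t) φf with hψf
  -- the coarse member: contraction, nonnegative losses, near-multiplier cross bounds
  have hTc : ∀ y, ‖T 0 t y‖ ≤ ‖y‖ := hT.norm_le 0 t
  have hq0 : ∀ y, 0 ≤ lossFwd (T 0 t) y := fun y => loss_nonneg hTc y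
  have hqs0 : ∀ y, 0 ≤ lossAdj (T 0 t) y := fun y => lossAdj_nonneg hTc y
  obtain ⟨hNMf, hNMa⟩ := hNM ν hν n hn 𝔸 hodd hwin hΦo hΦw θ hθ nC hnC0 hnC hnCK Tw hTw G hG J hR hR6 T hT t ht0 htT
  have hsplit : lossFwd (T 0 t) xs + lossFwd (T 0 t) xf ≤ lossFwd (T 0 t) x / (1 - κ) := by
    unfold lossFwd; rw [hx]
    exact loss_split_le_of_nearMult (T 0 t) hκ0 hκ hox (hq0 xs) (hq0 xf) (hNMf xs xf hxs_s hxf_f)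
  have hsplitA : lossAdj (T 0 t) ψs + lossAdj (T 0 t) ψf ≤ lossAdj (T 0 t) ζ / (1 - κ) := by
    have hTa : ∀ y, ‖ContinuousLinearMap.adjoint (T 0 t) y‖ ≤ ‖y‖ := norm_adjoint_le hTc
    have h1 : lossAdj (T 0 t) ψs + lossAdj (T 0 t) ψf ≤ lossAdj (T 0 t) ζ' / (1 - κ) := by
      unfold lossAdj; rw [hsplitζ]
      exact loss_split_le_of_lossForm (ContinuousLinearMap.adjoint (T 0 t)) hκ0 hκ (loss_nonneg hTa ψs) (loss_nonneg hTa ψf)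
        (hNMa φs φf hφs_s hφf_f hφs_div hφf_div)
    have h2 : lossAdj (T 0 t) ζ' ≤ lossAdj (T 0 t) ζ := by
      unfold lossAdj; rw [hζ']; exact lossAdj_starProjection_le Kt hrangeT ζ
    exact h1.trans (div_le_div_of_nonneg_right h2 (by linarith))
  -- the four block bounds at the pieces
  have b₁₁ := B₁ ν hν n hn 𝔸 hodd hwin hΦo hΦw θ hθ nC hnC0 hnC hnCK Tw hTw G hG J hR hR6 U T hU hT t ht0 htT xs φs hxs_s hφs_s hφs_div
  have b₁₂ := B₂ ν hν n hn 𝔸 hodd hwin hΦo hΦw θ hθ nC hnC0 hnC hnCK Tw hTw G hG J hR hR6 U T hU hT t ht0 htT xs φf hxs_s hφf_f hφf_div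
  have b₂₁ := B₃ ν hν n hn 𝔸 hodd hwin hΦo hΦw θ hθ nC hnC0 hnC hnCK Tw hTw G hG J hR hR6 U T hU hT t ht0 htT xf φs hxf_f hφs_s hφs_div
  have b₂₂ := B₄ ν hν n hn 𝔸 hodd hwin hΦo hΦw θ hθ nC hnC0 hnC hnCK Tw hTw G hG J hR hR6 U T hU hT t ht0 htT xf φf hxf_f hφf_f hφf_div
  -- common currency
  set a : ℝ := ν ^ σ' + ((⌈K / ν⌉₊ : ℝ) / n) ^ σ' + θ ^ σ' + (nC / n) ^ σ' with ha_def
  set m : ℝ := (min 1 ((M * W.period / ν) / t)) ^ σ' with hm_def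
  have ha0 : 0 ≤ a := by
    have h1 : 0 ≤ ν ^ σ' := Real.rpow_nonneg hν.1.le σ'
    have h2 : 0 ≤ ((⌈K / ν⌉₊ : ℝ) / n) ^ σ' := Real.rpow_nonneg (by positivity) σ'
    have h3 : 0 ≤ θ ^ σ' := Real.rpow_nonneg hθ.1 σ'
    have h4 : 0 ≤ (nC / n) ^ σ' := Real.rpow_nonneg (div_nonneg hnC0 (Nat.cast_nonneg n)) σ'
    rw [ha_def]; linarith
  have hP0 : 0 ≤ (M * W.period / ν) / t :=
    div_nonneg (div_nonneg (mul_nonneg hM.le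
      (Summit.AnomalousDissipation.AnomalousDissipation.Theorems.SolenoidalFractalHomogenisation.PermissibleCarrier.period_pos W).le) hν.1.le) ht0.le
  have hm0 : 0 ≤ m := by rw [hm_def]; exact Real.rpow_nonneg (le_min zero_le_one hP0) σ'
  have hη0 : ∀ {Cb : ℝ}, 0 ≤ Cb → 0 ≤ Cb * (Cb * a + m) := fun hCb => mul_nonneg hCb (by positivity)
  -- the test is seen only through its projection: `⟪U x − T x, ζ⟫ = ⟪U x − T x, ζ'⟫`
  have hvK : U 0 t x - T 0 t x ∈ Kt := Kt.sub_mem (hrangeU x) (hrangeT x)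
  have hpair : ⟪U 0 t x - T 0 t x, ζ⟫_ℝ = ⟪U 0 t x - T 0 t x, ζ'⟫_ℝ := by
    rw [hζ']; exact inner_eq_inner_starProjection_of_mem Kt hvK ζ
  -- bilinear expansion and the 2×2 bookkeeping with `A² = q(x)/(1−κ)`, `B² = q*(ζ)/(1−κ)`
  have hκ1 : 0 < 1 - κ := by linarith
  have hlin : U 0 t x - T 0 t x = (U 0 t xs - T 0 t xs) + (U 0 t xf - T 0 t xf) := by
    rw [hx, map_add, map_add]; abel
  have key := lossBound_add_blocks (v₁ := U 0 t xs - T 0 t xs) (v₂ := U 0 t xf - T 0 t xf) (ζ₁ := ψs) (ζ₂ := ψf)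
    (A := Real.sqrt (lossFwd (T 0 t) x / (1 - κ))) (B := Real.sqrt (lossAdj (T 0 t) ζ / (1 - κ)))
    b₁₁ b₁₂ b₂₁ b₂₂ (hη0 hC₁) (hη0 hC₂) (hη0 hC₃) (hη0 hC₄)
    (Real.sqrt_nonneg _) (Real.sqrt_nonneg _) (Real.sqrt_nonneg _) (Real.sqrt_nonneg _)
    (by rw [Real.sq_sqrt (hq0 xs), Real.sq_sqrt (hq0 xf), Real.sq_sqrt (div_nonneg (hq0 x) hκ1.le)]; exact hsplit)
    (by rw [Real.sq_sqrt (hqs0 ψs), Real.sq_sqrt (hqs0 ψf), Real.sq_sqrt (div_nonneg (hqs0 ζ) hκ1.le)]; exact hsplitA)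
  rw [hpair, hsplitζ, hlin]
  refine key.trans ?_
  have hsum := eta_sum_le (m := m) hC₁ hC₂ hC₃ hC₄ ha0
  set S : ℝ := C₁ + C₂ + C₃ + C₄ with hS
  have hS0 : 0 ≤ S := by rw [hS]; linarith
  have hsq : Real.sqrt (lossFwd (T 0 t) x / (1 - κ)) * Real.sqrt (lossAdj (T 0 t) ζ / (1 - κ))
      = (Real.sqrt (lossFwd (T 0 t) x) * Real.sqrt (lossAdj (T 0 t) ζ)) / (1 - κ) := by
    rw [Real.sqrt_div' _ hκ1.le, Real.sqrt_div' _ hκ1.le, div_mul_div_comm, Real.mul_self_sqrt hκ1.le]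
  have hXY : 0 ≤ Real.sqrt (lossFwd (T 0 t) x) * Real.sqrt (lossAdj (T 0 t) ζ) := by positivity
  have hinv1 : 1 ≤ 1 / (1 - κ) := by rw [le_div_iff₀ hκ1]; linarith
  have hCm : S * (S * a + m) / (1 - κ) ≤ S / (1 - κ) * (S / (1 - κ) * a + m) := by
    rw [div_eq_mul_one_div S, show S * (S * a + m) / (1 - κ) = S * (1 / (1 - κ)) * (S * a + m) by ring]
    refine mul_le_mul_of_nonneg_left ?_ (by positivity)
    have : S * a ≤ S * (1 / (1 - κ)) * a := by
      have := mul_le_mul_of_nonneg_left hinv1 (mul_nonneg hS0 ha0)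
      nlinarith [this]
    linarith
  calc (C₁ * (C₁ * a + m) + C₂ * (C₂ * a + m) + C₃ * (C₃ * a + m) + C₄ * (C₄ * a + m))
        * Real.sqrt (lossFwd (T 0 t) x / (1 - κ)) * Real.sqrt (lossAdj (T 0 t) ζ / (1 - κ))
      = (C₁ * (C₁ * a + m) + C₂ * (C₂ * a + m) + C₃ * (C₃ * a + m) + C₄ * (C₄ * a + m))
        * (Real.sqrt (lossFwd (T 0 t) x / (1 - κ)) * Real.sqrt (lossAdj (T 0 t) ζ / (1 - κ))) := by ring
    _ ≤ (S * (S * a + m)) * (Real.sqrt (lossFwd (T 0 t) x / (1 - κ)) * Real.sqrt (lossAdj (T 0 t) ζ / (1 - κ))) :=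
          mul_le_mul_of_nonneg_right hsum (by positivity)
    _ = (S * (S * a + m) / (1 - κ)) * (Real.sqrt (lossFwd (T 0 t) x) * Real.sqrt (lossAdj (T 0 t) ζ)) := by rw [hsq]; ring
    _ ≤ (S / (1 - κ) * (S / (1 - κ) * a + m)) * (Real.sqrt (lossFwd (T 0 t) x) * Real.sqrt (lossAdj (T 0 t) ζ)) :=
          mul_le_mul_of_nonneg_right hCm hXY
    _ = S / (1 - κ) * (S / (1 - κ) * a + m) * Real.sqrt (lossFwd (T 0 t) x) * Real.sqrt (lossAdj (T 0 t) ζ) := by ring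

end Summit.AnomalousDissipation.AnomalousDissipation.Theorems.SolenoidalFractalHomogenisation.LagrangianStep.VmodDist

end
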